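import Summits.CriticalPhenomena.PercolationContinuityZ3.Theorems.PercNearOneGluingAdditiveGluingKnBadBound
import HarnessLib

/-!
# `NoHeavyLowerTail` (stmt-CriticalPhenomena-4575) — three relays: the SECTOR-TRANSFER form of KN Question 7 (gen 5, `nh-dp-commonrelay`)

Support file (`--supports stmt-CriticalPhenomena-4575`); no definitions, no named facts, no sorries.  Setting of Kozma–Nitzan's
Theorem 2 (arXiv:2401.12397, pp. 8–9): relays `a₁, a₂, a₃` (designated `a₃`, `τ₃ ≤ τ₁, τ₂`), observer `o`, target `b`,
`X := μ(o↔A, o↔b) − μ(o↔A, a₃↔b) = (T₁₂ − U₁₂) + (T₁ − U₁) + (T₂ − U₂)` (tree: `stub_knThm2GoodSplit`) on the separation events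
`N₁₂ = {a₁,a₂ ↮ a₃}`, `N₁ = {a₁ ↮ a₂,a₃}`, `N₂`; `M := N₁ ∩ {a₂ ↮ a₃}` (all three relays separated), `P₁ = μ(N₁)`, `P_M = μ(M)`,
`A₁ = μ(N₁ ∩ {a₁↔o})`, `Mo₁ = μ(M ∩ {a₁↔o})` (`φ₁ = A₁/P₁`, `ψ₁ = Mo₁/P_M`), patterns `m_T = μ(C(b) ∩ A = T)`, `m₃ᴹ := μ(M ∩ {a₃↔b})`.
Contents (memo RESIDUAL-gen5.md in run/shared/lean/prim/prim-nh-dp-commonrelay/ has the censuses: 0 violations of every displayed hypothesis):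
* PROVED: `sector_delta_le` (`τ₃ ≤ τ₁ ⟹ m₃ ≤ m₁₂ + m₃ᴹ`, KN Lemma 3(i) with `Q = {a₁↔a₂}`, re-derived from the set-BHK facts
  `stub_bhkSets` in `sector_lemma3i_pair`) and `sector_psi_ge_phi` (`P_M A₁ ≤ P₁ Mo₁`, i.e. `ψ₁ ≥ φ₁`, BHK Thm 1.4).
* `preFKG3_of_sectorTransfer`: pre-FKG (3) at `a₃` (KN Question 7 for three relays = first open rung of `stub_dcone`) from the three
  division-free SECTOR inequalities (I) `P_M (T₁₂−U₁₂) ≥ (Mo₁+Mo₂)(m₁₂−m₃)` (= CLAIM-I-ψ of the coupling seat / ttrl2 tot3 census),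
  (II) `P₁ P_M (T₁−U₁) ≥ P_M A₁ (τ₁−τ₃) + P₁ Mo₁ (m₃−m₁₂)`, (III) mirror; their sum is `TOT3` (`X ≥ φ₁(τ₁−τ₃) + φ₂(τ₂−τ₃)`).
* `sectorII_of_sigma`: (II) ⟸ `τ₃ ≤ τ₁` ∧ the HYPOTHESIS-FREE candidate row `Σ₁ : (P₁ Mo₁ − P_M A₁) m₃ᴹ ≤ P_M [P₁ (T₁−U₁) − A₁ (m₁−m₂₃)]`
  (KN's BHK slack of sector II is at least `(ψ₁ − φ₁) μ(M ∩ {a₃↔b})`); `preFKG3_of_claimI_sigma`: (3) at `a₃` ⟸ CLAIM-I-ψ ∧ Σ₁ ∧ Σ₂.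
[cite: KozmaNitzan2024, Theorem 2 (§3.1, pp. 8–9), Lemma 3(i) (pp. 6–7), Question 7 (§5.5, p. 36); VandenbergHaggstromKahn2005, Thms. 1.3–1.4]
-/

namespace Summit.CriticalPhenomena.PercolationContinuityZ3.Theorems

open MeasureTheory Set Literature.Probability.LatticeModels Literature.Probability.Percolation

noncomputable section
open Classical

variable {n : ℕ}

/-! ### Event identities -/

/-- The part of `N₁₂ ∩ {a₃↔b}` where `a₁ ↔ a₂`, on the separation event `{a₁ ↮ a₃}`. [folklore] -/
theorem sector_m3_conn (b a₁ a₂ a₃ : Fin n) :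
    ((openConn a₁ a₃)ᶜ ∩ (openConn a₁ a₂ ∩ openConn a₃ b) : Set (BondConfig (Fin n))) =
      (openConn a₁ a₃)ᶜ ∩ (openConn a₂ a₃)ᶜ ∩ openConn a₃ b ∩ openConn a₁ a₂ := by
  ext ω
  simp only [Set.mem_inter_iff, Set.mem_compl_iff, knThm2_mem_openConn]
  constructor
  · rintro ⟨h13, h12, h3b⟩
    exact ⟨⟨⟨h13, fun h => h13 (h12.trans h)⟩, h3b⟩, h12⟩
  · rintro ⟨⟨⟨h13, _⟩, h3b⟩, h12⟩
    exact ⟨h13, h12, h3b⟩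

/-- The pattern `m₁₂` on the separation event `{a₁ ↮ a₃}`. [folklore] -/
theorem sector_m12_conn (b a₁ a₂ a₃ : Fin n) :
    ((openConn a₁ a₃)ᶜ ∩ (openConn a₁ a₂ ∩ openConn a₁ b) : Set (BondConfig (Fin n))) =
      (openConn a₁ a₃)ᶜ ∩ (openConn a₂ a₃)ᶜ ∩ (openConn a₁ b ∩ openConn a₂ b) := by
  ext ω
  simp only [Set.mem_inter_iff, Set.mem_compl_iff, knThm2_mem_openConn]
  constructor
  · rintro ⟨h13, h12, h1b⟩
    exact ⟨⟨h13, fun h => h13 (h12.trans h)⟩, h1b, h12.symm.trans h1b⟩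
  · rintro ⟨⟨h13, _⟩, h1b, h2b⟩
    exact ⟨h13, h1b.trans h2b.symm, h1b⟩

/-- `{S ↮ S'}` for the singletons `S = {a₁}`, `S' = {a₃}` (finsets). [folklore] -/
theorem sector_sep11_finset (a₁ a₃ : Fin n) :
    {ω : BondConfig (Fin n) | ∀ s ∈ ({a₁} : Finset (Fin n)), ∀ x ∈ ({a₃} : Finset (Fin n)),
        ¬ (openGraph ω).Reachable s x} = (openConn a₁ a₃)ᶜ := by
  ext ω
  simp only [Finset.mem_singleton, forall_eq, Set.mem_setOf_eq, Set.mem_compl_iff, knThm2_mem_openConn]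

/-- `{S ↮ X}` for `S = {a₁}`, `X = {a₃} ⊆ V`. [folklore] -/
theorem sector_sep11_set (a₁ a₃ : Fin n) :
    {ω : BondConfig (Fin n) | ∀ s ∈ ({a₁} : Finset (Fin n)), ∀ x ∈ ({a₃} : Set (Fin n)),
        ¬ (openGraph ω).Reachable s x} = (openConn a₁ a₃)ᶜ := by
  ext ω
  simp only [Finset.mem_singleton, Set.mem_singleton_iff, forall_eq, Set.mem_setOf_eq, Set.mem_compl_iff,
    knThm2_mem_openConn]

/-- **KN Lemma 3(i) with `Q = {a₁ ↔ a₂}`, tripod form (PROVED):** if `τ₃ ≤ τ₁` then `μ(a₁↮a₃, a₁↔a₂, a₃↔b) ≤ μ(a₁↮a₃, a₁↔a₂, a₁↔b)`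
(KN's proof: on `D = {a₁ ↮ a₃}` the hypothesis is `μ(D, a₃↔b) ≤ μ(D, a₁↔b)`; BHK Thm 1.4 and Thm 1.3 on `D`, set forms `stub_bhkSets`).
[cite: KozmaNitzan2024, Lemma 3(i) (pp. 6–7); VandenbergHaggstromKahn2005, Thms. 1.3–1.4] -/
theorem sector_lemma3i_pair (w : Sym2 (Fin n) → unitInterval) (b a₁ a₂ a₃ : Fin n) (h13 : a₁ ≠ a₃)
    (hτ : (prodBernoulli w).real (openConn a₃ b) ≤ (prodBernoulli w).real (openConn a₁ b)) :
    (prodBernoulli w).real ((openConn a₁ a₃)ᶜ ∩ (openConn a₁ a₂ ∩ openConn a₃ b)) ≤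
      (prodBernoulli w).real ((openConn a₁ a₃)ᶜ ∩ (openConn a₁ a₂ ∩ openConn a₁ b)) := by
  have i2 := knThm2_bhkTwo stub_bhkSets.2 w {a₁} {a₃} a₂ b (by simp [h13])
  rw [sector_sep11_finset, Finset.set_biUnion_singleton, Finset.set_biInter_singleton] at i2
  have i1 := knThm2_bhkOne stub_bhkSets.1 w {a₁} ({a₃} : Set (Fin n)) a₂ b (by simp [h13])
  rw [sector_sep11_set, Finset.set_biUnion_singleton, Finset.set_biInter_singleton] at i1
  -- the hypothesis on `D`: remove the common part `{a₁ ↔ a₃}`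
  have hs3 := measureReal_inter_add_sdiff (μ := prodBernoulli w) (s := (openConn a₃ b : Set (BondConfig (Fin n))))
    (t := openConn a₁ a₃) MeasurableSet.of_discrete
  have hs1 := measureReal_inter_add_sdiff (μ := prodBernoulli w) (s := (openConn a₁ b : Set (BondConfig (Fin n))))
    (t := openConn a₁ a₃) MeasurableSet.of_discrete
  have ec : (openConn a₃ b ∩ openConn a₁ a₃ : Set (BondConfig (Fin n))) = openConn a₁ b ∩ openConn a₁ a₃ := by
    ext ω; simp only [Set.mem_inter_iff, knThm2_mem_openConn]
    exact ⟨fun ⟨h3b, h13'⟩ => ⟨h13'.trans h3b, h13'⟩, fun ⟨h1b, h13'⟩ => ⟨h13'.symm.trans h1b, h13'⟩⟩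
  have ed3 : (openConn a₃ b \ openConn a₁ a₃ : Set (BondConfig (Fin n))) = (openConn a₁ a₃)ᶜ ∩ openConn a₃ b := by
    ext ω; simp only [Set.mem_sdiff, Set.mem_inter_iff, Set.mem_compl_iff]; tauto
  have ed1 : (openConn a₁ b \ openConn a₁ a₃ : Set (BondConfig (Fin n))) = (openConn a₁ a₃)ᶜ ∩ openConn a₁ b := by
    ext ω; simp only [Set.mem_sdiff, Set.mem_inter_iff, Set.mem_compl_iff]; tauto
  rw [ec, ed3] at hs3
  rw [ed1] at hs1
  have hD : (prodBernoulli w).real ((openConn a₁ a₃)ᶜ ∩ openConn a₃ b) ≤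
      (prodBernoulli w).real ((openConn a₁ a₃)ᶜ ∩ openConn a₁ b) := by linarith
  -- chain the two BHK bounds through the hypothesis
  have hA : 0 ≤ (prodBernoulli w).real ((openConn a₁ a₃)ᶜ ∩ openConn a₁ a₂) := measureReal_nonneg
  have hchain : (prodBernoulli w).real ((openConn a₁ a₃)ᶜ : Set (BondConfig (Fin n))) *
        (prodBernoulli w).real ((openConn a₁ a₃)ᶜ ∩ (openConn a₁ a₂ ∩ openConn a₃ b)) ≤
      (prodBernoulli w).real ((openConn a₁ a₃)ᶜ : Set (BondConfig (Fin n))) *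
        (prodBernoulli w).real ((openConn a₁ a₃)ᶜ ∩ (openConn a₁ a₂ ∩ openConn a₁ b)) :=
    calc (prodBernoulli w).real ((openConn a₁ a₃)ᶜ : Set (BondConfig (Fin n))) *
          (prodBernoulli w).real ((openConn a₁ a₃)ᶜ ∩ (openConn a₁ a₂ ∩ openConn a₃ b))
        ≤ (prodBernoulli w).real ((openConn a₁ a₃)ᶜ ∩ openConn a₁ a₂) *
            (prodBernoulli w).real ((openConn a₁ a₃)ᶜ ∩ openConn a₃ b) := i2
      _ ≤ (prodBernoulli w).real ((openConn a₁ a₃)ᶜ ∩ openConn a₁ a₂) *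
            (prodBernoulli w).real ((openConn a₁ a₃)ᶜ ∩ openConn a₁ b) := mul_le_mul_of_nonneg_left hD hA
      _ ≤ (prodBernoulli w).real ((openConn a₁ a₃)ᶜ : Set (BondConfig (Fin n))) *
            (prodBernoulli w).real ((openConn a₁ a₃)ᶜ ∩ (openConn a₁ a₂ ∩ openConn a₁ b)) := i1
  by_cases hD0 : (prodBernoulli w).real ((openConn a₁ a₃)ᶜ : Set (BondConfig (Fin n))) = 0
  · have h0 : (prodBernoulli w).real ((openConn a₁ a₃)ᶜ ∩ (openConn a₁ a₂ ∩ openConn a₃ b)) = 0 :=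
      le_antisymm ((measureReal_mono Set.inter_subset_left).trans hD0.le) measureReal_nonneg
    rw [h0]; exact measureReal_nonneg
  · exact le_of_mul_le_mul_left hchain (lt_of_le_of_ne measureReal_nonneg (Ne.symm hD0))

/-- The part of `N₁₂ ∩ {a₃↔b}` where `a₁ ↮ a₂` is `M ∩ {a₃↔b}` (all three relays separated). [folklore] -/
theorem sector_m3_sep (b a₁ a₂ a₃ : Fin n) :
    (((openConn a₁ a₃)ᶜ ∩ (openConn a₂ a₃)ᶜ ∩ openConn a₃ b) \ openConn a₁ a₂ : Set (BondConfig (Fin n))) =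
      (openConn a₁ a₂)ᶜ ∩ (openConn a₁ a₃)ᶜ ∩ (openConn a₂ a₃)ᶜ ∩ openConn a₃ b := by
  ext ω
  simp only [Set.mem_sdiff, Set.mem_inter_iff, Set.mem_compl_iff, knThm2_mem_openConn]
  tauto

/-- `M ∩ {a₁↔o}` as `N₁ ∩ {a₁↔o}` minus its part with `a₂ ↔ a₃`. [folklore] -/
theorem sector_Mo_eq (o a₁ a₂ a₃ : Fin n) :
    (((openConn a₁ a₂)ᶜ ∩ (openConn a₁ a₃)ᶜ ∩ openConn a₁ o) \ openConn a₂ a₃ : Set (BondConfig (Fin n))) =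
      (openConn a₁ a₂)ᶜ ∩ (openConn a₁ a₃)ᶜ ∩ (openConn a₂ a₃)ᶜ ∩ openConn a₁ o := by
  ext ω
  simp only [Set.mem_sdiff, Set.mem_inter_iff, Set.mem_compl_iff]
  tauto

/-- `M` as `N₁` minus its part with `a₂ ↔ a₃`. [folklore] -/
theorem sector_M_eq (a₁ a₂ a₃ : Fin n) :
    (((openConn a₁ a₂)ᶜ ∩ (openConn a₁ a₃)ᶜ) \ openConn a₂ a₃ : Set (BondConfig (Fin n))) =
      (openConn a₁ a₂)ᶜ ∩ (openConn a₁ a₃)ᶜ ∩ (openConn a₂ a₃)ᶜ := by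
  ext ω
  simp only [Set.mem_sdiff, Set.mem_inter_iff, Set.mem_compl_iff]

/-! ### The two proved transfers -/

/-- **`Δ ≤ m₃ᴹ` (PROVED).**  If `τ₃ ≤ τ₁` then `m₃ ≤ m₁₂ + μ(M ∩ {a₃↔b})`: the part of the pattern
`C(b) ∩ A = {a₃}` where `a₁ ↔ a₂` is lighter than the pattern `{a₁, a₂}` (KN Lemma 3(i) with the increasing event
`{a₁↔a₂}` of the cluster of `a₁`: `μ(a₃↔b, a₁↔a₂, a₃↮a₁) ≤ μ(a₁↔b, a₁↔a₂, a₃↮a₁)`), and the rest is `M ∩ {a₃↔b}`.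
[cite: KozmaNitzan2024, Lemma 3(i) (pp. 6–7)] -/
theorem sector_delta_le (w : Sym2 (Fin n) → unitInterval) (b a₁ a₂ a₃ : Fin n) (h13 : a₁ ≠ a₃)
    (hτ : (prodBernoulli w).real (openConn a₃ b) ≤ (prodBernoulli w).real (openConn a₁ b)) :
    (prodBernoulli w).real ((openConn a₁ a₃)ᶜ ∩ (openConn a₂ a₃)ᶜ ∩ openConn a₃ b) ≤
      (prodBernoulli w).real ((openConn a₁ a₃)ᶜ ∩ (openConn a₂ a₃)ᶜ ∩ (openConn a₁ b ∩ openConn a₂ b)) +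
        (prodBernoulli w).real ((openConn a₁ a₂)ᶜ ∩ (openConn a₁ a₃)ᶜ ∩ (openConn a₂ a₃)ᶜ ∩ openConn a₃ b) := by
  have key := sector_lemma3i_pair w b a₁ a₂ a₃ h13 hτ
  rw [sector_m3_conn b a₁ a₂ a₃, sector_m12_conn b a₁ a₂ a₃] at key
  have hsplit := measureReal_inter_add_sdiff (μ := prodBernoulli w)
    (s := ((openConn a₁ a₃)ᶜ ∩ (openConn a₂ a₃)ᶜ ∩ openConn a₃ b : Set (BondConfig (Fin n))))
    (t := openConn a₁ a₂) MeasurableSet.of_discrete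
  rw [sector_m3_sep b a₁ a₂ a₃] at hsplit
  linarith

/-- **`ψ₁ ≥ φ₁` (PROVED), division-free: `μ(M) · μ(N₁ ∩ {a₁↔o}) ≤ μ(N₁) · μ(M ∩ {a₁↔o})`** — the observer is
attached to `a₁` more often when the two other relays are separated (BHK 2006 Thm. 1.4 on `N₁ = {a₁ ↮ a₂, a₃}`:
`{a₁↔o}` is increasing in `C(a₁)`, `{a₂↔a₃}` in `C({a₂,a₃})`; KN Lemma 1(ii)).
[cite: VandenbergHaggstromKahn2005, Thm. 1.4 (p. 7); KozmaNitzan2024, Lemma 1 (pp. 5–6)] -/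
theorem sector_psi_ge_phi (w : Sym2 (Fin n) → unitInterval) (o a₁ a₂ a₃ : Fin n) (h12 : a₁ ≠ a₂) (h13 : a₁ ≠ a₃) :
    (prodBernoulli w).real ((openConn a₁ a₂)ᶜ ∩ (openConn a₁ a₃)ᶜ ∩ (openConn a₂ a₃)ᶜ) *
        (prodBernoulli w).real ((openConn a₁ a₂)ᶜ ∩ (openConn a₁ a₃)ᶜ ∩ openConn a₁ o) ≤
      (prodBernoulli w).real ((openConn a₁ a₂)ᶜ ∩ (openConn a₁ a₃)ᶜ) *
        (prodBernoulli w).real ((openConn a₁ a₂)ᶜ ∩ (openConn a₁ a₃)ᶜ ∩ (openConn a₂ a₃)ᶜ ∩ openConn a₁ o) := by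
  have i := knThm2_bhkTwo stub_bhkSets.2 w {a₁} {a₂, a₃} o a₃ (by simp [h12, h13])
  have hself : (openConn a₃ a₃ : Set (BondConfig (Fin n))) = Set.univ :=
    Set.eq_univ_of_forall fun _ => SimpleGraph.Reachable.refl _
  rw [knThm2_sep_single_finset, Finset.set_biUnion_singleton, Finset.set_biInter_insert,
    Finset.set_biInter_singleton, hself, Set.inter_univ] at i
  -- i : P₁ · μ(N₁ ∩ ({a₁↔o} ∩ {a₂↔a₃})) ≤ μ(N₁ ∩ {a₁↔o}) · μ(N₁ ∩ {a₂↔a₃})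
  have hs1 := measureReal_inter_add_sdiff (μ := prodBernoulli w)
    (s := ((openConn a₁ a₂)ᶜ ∩ (openConn a₁ a₃)ᶜ ∩ openConn a₁ o : Set (BondConfig (Fin n))))
    (t := openConn a₂ a₃) MeasurableSet.of_discrete
  have hs2 := measureReal_inter_add_sdiff (μ := prodBernoulli w)
    (s := ((openConn a₁ a₂)ᶜ ∩ (openConn a₁ a₃)ᶜ : Set (BondConfig (Fin n))))
    (t := openConn a₂ a₃) MeasurableSet.of_discrete
  rw [sector_Mo_eq] at hs1
  rw [sector_M_eq] at hs2
  have e1 : ((openConn a₁ a₂)ᶜ ∩ (openConn a₁ a₃)ᶜ ∩ openConn a₁ o ∩ openConn a₂ a₃ : Set (BondConfig (Fin n))) =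
      (openConn a₁ a₂)ᶜ ∩ (openConn a₁ a₃)ᶜ ∩ (openConn a₁ o ∩ openConn a₂ a₃) := by
    rw [Set.inter_assoc]
  rw [e1] at hs1
  have hA : 0 ≤ (prodBernoulli w).real ((openConn a₁ a₂)ᶜ ∩ (openConn a₁ a₃)ᶜ ∩ openConn a₁ o) :=
    measureReal_nonneg
  have hB : (prodBernoulli w).real ((openConn a₁ a₂)ᶜ ∩ (openConn a₁ a₃)ᶜ ∩ openConn a₁ o) ≤
      (prodBernoulli w).real ((openConn a₁ a₂)ᶜ ∩ (openConn a₁ a₃)ᶜ : Set (BondConfig (Fin n))) :=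
    measureReal_mono Set.inter_subset_left
  nlinarith [i, hs1, hs2, hA, hB]

/-! ### Real arithmetic -/

/-- **Arithmetic of the sector transfer**: (I)+(II)+(III) give `P₁ P₂ P_M X ≥ P_M (P₂ A₁ (τ₁−τ₃) + P₁ A₂ (τ₂−τ₃)) ≥ 0`
(the `Δ`-terms cancel), hence `X ≥ 0`. [this file] -/
theorem sector_arith {X T₁₂ U₁₂ T₁ U₁ T₂ U₂ P₁ P₂ PM A₁ A₂ Mo₁ Mo₂ m₁₂ m₃ t₁ t₂ : ℝ}
    (hX : X = (T₁₂ - U₁₂) + (T₁ - U₁) + (T₂ - U₂))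
    (hPM : 0 < PM) (hP₁ : PM ≤ P₁) (hP₂ : PM ≤ P₂) (hA₁ : 0 ≤ A₁) (hA₂ : 0 ≤ A₂) (ht₁ : 0 ≤ t₁) (ht₂ : 0 ≤ t₂)
    (hI : (Mo₁ + Mo₂) * (m₁₂ - m₃) ≤ PM * (T₁₂ - U₁₂))
    (hII : PM * A₁ * t₁ + P₁ * Mo₁ * (m₃ - m₁₂) ≤ P₁ * PM * (T₁ - U₁))
    (hIII : PM * A₂ * t₂ + P₂ * Mo₂ * (m₃ - m₁₂) ≤ P₂ * PM * (T₂ - U₂)) : 0 ≤ X := by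
  have hP₁' : 0 < P₁ := lt_of_lt_of_le hPM hP₁
  have hP₂' : 0 < P₂ := lt_of_lt_of_le hPM hP₂
  have h1 : P₁ * P₂ * ((Mo₁ + Mo₂) * (m₁₂ - m₃)) ≤ P₁ * P₂ * (PM * (T₁₂ - U₁₂)) :=
    mul_le_mul_of_nonneg_left hI (mul_nonneg hP₁'.le hP₂'.le)
  have h2 : P₂ * (PM * A₁ * t₁ + P₁ * Mo₁ * (m₃ - m₁₂)) ≤ P₂ * (P₁ * PM * (T₁ - U₁)) :=
    mul_le_mul_of_nonneg_left hII hP₂'.le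
  have h3 : P₁ * (PM * A₂ * t₂ + P₂ * Mo₂ * (m₃ - m₁₂)) ≤ P₁ * (P₂ * PM * (T₂ - U₂)) :=
    mul_le_mul_of_nonneg_left hIII hP₁'.le
  have hsum : PM * (P₂ * A₁ * t₁ + P₁ * A₂ * t₂) ≤ P₁ * P₂ * PM * X := by
    rw [hX]; nlinarith [h1, h2, h3]
  have hnn : 0 ≤ PM * (P₂ * A₁ * t₁ + P₁ * A₂ * t₂) := by positivity
  have hprod : 0 < P₁ * P₂ * PM := by positivity
  by_contra hneg
  push Not at hneg
  have : P₁ * P₂ * PM * X < 0 := mul_neg_of_pos_of_neg hprod hneg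
  linarith

/-- **Arithmetic of `Σ₁ ⟹ (II)`**: `PM A₁ (τ₁−τ₃) + P₁ Mo₁ Δ = PM A₁ (m₁−m₂₃) + (P₁ Mo₁ − PM A₁) Δ ≤ PM A₁ (m₁−m₂₃) + (P₁ Mo₁ − PM A₁) m₃ᴹ`
(as `Δ ≤ m₃ᴹ`, `PM A₁ ≤ P₁ Mo₁`) `≤ P₁ PM (T₁−U₁)` (by `Σ₁`). [this file] -/
theorem sectorII_arith {T₁ U₁ P₁ PM A₁ Mo₁ m₁₂ m₃ m₁ m₂₃ m₃M t₁ : ℝ}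
    (hSig : (P₁ * Mo₁ - PM * A₁) * m₃M ≤ PM * (P₁ * (T₁ - U₁) - A₁ * (m₁ - m₂₃)))
    (ht : t₁ = (m₁₂ + m₁) - (m₂₃ + m₃)) (hΔ : m₃ ≤ m₁₂ + m₃M) (hψ : PM * A₁ ≤ P₁ * Mo₁) :
    PM * A₁ * t₁ + P₁ * Mo₁ * (m₃ - m₁₂) ≤ P₁ * PM * (T₁ - U₁) := by
  have hkey : 0 ≤ (P₁ * Mo₁ - PM * A₁) * (m₁₂ + m₃M - m₃) :=
    mul_nonneg (by linarith) (by linarith)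
  rw [ht]
  nlinarith [hSig, hkey]

/-! ### The sector-transfer theorem -/

/-- **KN Question 7 at three relays from the three SECTOR-TRANSFER inequalities.**  Relays `a₁, a₂, a₃` pairwise
distinct, `τ₃ ≤ τ₁`, `τ₃ ≤ τ₂`, `μ(M) > 0` (`M` = all three relays separated).  Division-free hypotheses, in the
notation of the module docstring (`N₁₂ = {a₁↮a₃}∩{a₂↮a₃}`, `N₁ = {a₁↮a₂}∩{a₁↮a₃}`, `N₂ = {a₂↮a₁}∩{a₂↮a₃}`,
`M = N₁ ∩ {a₂↮a₃}`):
(I)  `(μ(M∩{a₁↔o}) + μ(M∩{a₂↔o})) · (m₁₂ − m₃) ≤ μ(M) · (T₁₂ − U₁₂)`  (CLAIM-I-ψ),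
(II) `μ(M) μ(N₁∩{a₁↔o}) (τ₁−τ₃) + μ(N₁) μ(M∩{a₁↔o}) (m₃ − m₁₂) ≤ μ(N₁) μ(M) (T₁ − U₁)`,
(III) the same with `a₁ ↔ a₂` exchanged.  Then `μ(o↔A, a₃↔b) ≤ μ(o↔A, o↔b)` (pre-FKG (3) at `a₃`).
Proof: `X = I + II + III` (`stub_knThm2GoodSplit`) and `sector_arith`.
[cite: KozmaNitzan2024, Theorem 2 (pp. 8–9), Question 7 (p. 36)] -/
theorem preFKG3_of_sectorTransfer (w : Sym2 (Fin n) → unitInterval) (o b a₁ a₂ a₃ : Fin n)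
    (hM : 0 < (prodBernoulli w).real ((openConn a₁ a₂)ᶜ ∩ (openConn a₁ a₃)ᶜ ∩ (openConn a₂ a₃)ᶜ : Set (BondConfig (Fin n))))
    (hτ₁ : (prodBernoulli w).real (openConn a₃ b) ≤ (prodBernoulli w).real (openConn a₁ b))
    (hτ₂ : (prodBernoulli w).real (openConn a₃ b) ≤ (prodBernoulli w).real (openConn a₂ b))
    (hI : ((prodBernoulli w).real ((openConn a₁ a₂)ᶜ ∩ (openConn a₁ a₃)ᶜ ∩ (openConn a₂ a₃)ᶜ ∩ openConn a₁ o) +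
            (prodBernoulli w).real ((openConn a₁ a₂)ᶜ ∩ (openConn a₁ a₃)ᶜ ∩ (openConn a₂ a₃)ᶜ ∩ openConn a₂ o)) *
          ((prodBernoulli w).real ((openConn a₁ a₃)ᶜ ∩ (openConn a₂ a₃)ᶜ ∩ (openConn a₁ b ∩ openConn a₂ b)) -
            (prodBernoulli w).real ((openConn a₁ a₃)ᶜ ∩ (openConn a₂ a₃)ᶜ ∩ openConn a₃ b)) ≤
        (prodBernoulli w).real ((openConn a₁ a₂)ᶜ ∩ (openConn a₁ a₃)ᶜ ∩ (openConn a₂ a₃)ᶜ : Set (BondConfig (Fin n))) *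
          ((prodBernoulli w).real ((openConn a₁ a₃)ᶜ ∩ (openConn a₂ a₃)ᶜ ∩ ((openConn a₁ o ∪ openConn a₂ o) ∩ (openConn a₁ b ∩ openConn a₂ b))) -
            (prodBernoulli w).real ((openConn a₁ a₃)ᶜ ∩ (openConn a₂ a₃)ᶜ ∩ ((openConn a₁ o ∪ openConn a₂ o) ∩ openConn a₃ b))))
    (hII : (prodBernoulli w).real ((openConn a₁ a₂)ᶜ ∩ (openConn a₁ a₃)ᶜ ∩ (openConn a₂ a₃)ᶜ : Set (BondConfig (Fin n))) *
            (prodBernoulli w).real ((openConn a₁ a₂)ᶜ ∩ (openConn a₁ a₃)ᶜ ∩ openConn a₁ o) *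
            ((prodBernoulli w).real (openConn a₁ b) - (prodBernoulli w).real (openConn a₃ b)) +
          (prodBernoulli w).real ((openConn a₁ a₂)ᶜ ∩ (openConn a₁ a₃)ᶜ : Set (BondConfig (Fin n))) *
            (prodBernoulli w).real ((openConn a₁ a₂)ᶜ ∩ (openConn a₁ a₃)ᶜ ∩ (openConn a₂ a₃)ᶜ ∩ openConn a₁ o) *
            ((prodBernoulli w).real ((openConn a₁ a₃)ᶜ ∩ (openConn a₂ a₃)ᶜ ∩ openConn a₃ b) -
              (prodBernoulli w).real ((openConn a₁ a₃)ᶜ ∩ (openConn a₂ a₃)ᶜ ∩ (openConn a₁ b ∩ openConn a₂ b))) ≤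
        (prodBernoulli w).real ((openConn a₁ a₂)ᶜ ∩ (openConn a₁ a₃)ᶜ : Set (BondConfig (Fin n))) *
          (prodBernoulli w).real ((openConn a₁ a₂)ᶜ ∩ (openConn a₁ a₃)ᶜ ∩ (openConn a₂ a₃)ᶜ : Set (BondConfig (Fin n))) *
          ((prodBernoulli w).real ((openConn a₁ a₂)ᶜ ∩ (openConn a₁ a₃)ᶜ ∩ (openConn a₁ o ∩ openConn a₁ b)) -
            (prodBernoulli w).real ((openConn a₁ a₂)ᶜ ∩ (openConn a₁ a₃)ᶜ ∩ (openConn a₁ o ∩ (openConn a₂ b ∩ openConn a₃ b)))))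
    (hIII : (prodBernoulli w).real ((openConn a₁ a₂)ᶜ ∩ (openConn a₁ a₃)ᶜ ∩ (openConn a₂ a₃)ᶜ : Set (BondConfig (Fin n))) *
            (prodBernoulli w).real ((openConn a₂ a₁)ᶜ ∩ (openConn a₂ a₃)ᶜ ∩ openConn a₂ o) *
            ((prodBernoulli w).real (openConn a₂ b) - (prodBernoulli w).real (openConn a₃ b)) +
          (prodBernoulli w).real ((openConn a₂ a₁)ᶜ ∩ (openConn a₂ a₃)ᶜ : Set (BondConfig (Fin n))) *
            (prodBernoulli w).real ((openConn a₁ a₂)ᶜ ∩ (openConn a₁ a₃)ᶜ ∩ (openConn a₂ a₃)ᶜ ∩ openConn a₂ o) *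
            ((prodBernoulli w).real ((openConn a₁ a₃)ᶜ ∩ (openConn a₂ a₃)ᶜ ∩ openConn a₃ b) -
              (prodBernoulli w).real ((openConn a₁ a₃)ᶜ ∩ (openConn a₂ a₃)ᶜ ∩ (openConn a₁ b ∩ openConn a₂ b))) ≤
        (prodBernoulli w).real ((openConn a₂ a₁)ᶜ ∩ (openConn a₂ a₃)ᶜ : Set (BondConfig (Fin n))) *
          (prodBernoulli w).real ((openConn a₁ a₂)ᶜ ∩ (openConn a₁ a₃)ᶜ ∩ (openConn a₂ a₃)ᶜ : Set (BondConfig (Fin n))) *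
          ((prodBernoulli w).real ((openConn a₂ a₁)ᶜ ∩ (openConn a₂ a₃)ᶜ ∩ (openConn a₂ o ∩ openConn a₂ b)) -
            (prodBernoulli w).real ((openConn a₂ a₁)ᶜ ∩ (openConn a₂ a₃)ᶜ ∩ (openConn a₂ o ∩ (openConn a₁ b ∩ openConn a₃ b))))) :
    (prodBernoulli w).real ((openConn o a₁ ∪ openConn o a₂ ∪ openConn o a₃) ∩ openConn a₃ b) ≤
      (prodBernoulli w).real ((openConn o a₁ ∪ openConn o a₂ ∪ openConn o a₃) ∩ openConn o b) := by
  have hX := stub_knThm2GoodSplit n w o b a₁ a₂ a₃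
  -- `P₁, P₂ ≥ P_M`
  have hP₁ : (prodBernoulli w).real ((openConn a₁ a₂)ᶜ ∩ (openConn a₁ a₃)ᶜ ∩ (openConn a₂ a₃)ᶜ : Set (BondConfig (Fin n))) ≤
      (prodBernoulli w).real ((openConn a₁ a₂)ᶜ ∩ (openConn a₁ a₃)ᶜ : Set (BondConfig (Fin n))) :=
    measureReal_mono Set.inter_subset_left
  have hsub₂ : ((openConn a₁ a₂)ᶜ ∩ (openConn a₁ a₃)ᶜ ∩ (openConn a₂ a₃)ᶜ : Set (BondConfig (Fin n))) ⊆
      (openConn a₂ a₁)ᶜ ∩ (openConn a₂ a₃)ᶜ := by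
    intro ω hω
    simp only [Set.mem_inter_iff, Set.mem_compl_iff, knThm2_mem_openConn] at hω ⊢
    exact ⟨fun h => hω.1.1 h.symm, hω.2⟩
  have hP₂ := measureReal_mono (μ := prodBernoulli w) hsub₂
  have key := sector_arith (sub_eq_of_eq_add' (by linarith [hX] :
      (prodBernoulli w).real ((openConn o a₁ ∪ openConn o a₂ ∪ openConn o a₃) ∩ openConn o b) =
        (prodBernoulli w).real ((openConn o a₁ ∪ openConn o a₂ ∪ openConn o a₃) ∩ openConn a₃ b) +
          (((prodBernoulli w).real ((openConn a₁ a₃)ᶜ ∩ (openConn a₂ a₃)ᶜ ∩ ((openConn a₁ o ∪ openConn a₂ o) ∩ (openConn a₁ b ∩ openConn a₂ b))) -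
              (prodBernoulli w).real ((openConn a₁ a₃)ᶜ ∩ (openConn a₂ a₃)ᶜ ∩ ((openConn a₁ o ∪ openConn a₂ o) ∩ openConn a₃ b))) +
            ((prodBernoulli w).real ((openConn a₁ a₂)ᶜ ∩ (openConn a₁ a₃)ᶜ ∩ (openConn a₁ o ∩ openConn a₁ b)) -
              (prodBernoulli w).real ((openConn a₁ a₂)ᶜ ∩ (openConn a₁ a₃)ᶜ ∩ (openConn a₁ o ∩ (openConn a₂ b ∩ openConn a₃ b)))) +
            ((prodBernoulli w).real ((openConn a₂ a₁)ᶜ ∩ (openConn a₂ a₃)ᶜ ∩ (openConn a₂ o ∩ openConn a₂ b)) -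
              (prodBernoulli w).real ((openConn a₂ a₁)ᶜ ∩ (openConn a₂ a₃)ᶜ ∩ (openConn a₂ o ∩ (openConn a₁ b ∩ openConn a₃ b)))))))
    hM hP₁ hP₂ measureReal_nonneg measureReal_nonneg (sub_nonneg.2 hτ₁) (sub_nonneg.2 hτ₂) hI hII hIII
  linarith

/-- **(II) from the hypothesis-free row `Σ₁` (and `τ₃ ≤ τ₁`).**  `Σ₁`, division-free:
`(P₁ Mo₁ − P_M A₁) · μ(M ∩ {a₃↔b}) ≤ P_M · (P₁ (T₁ − U₁) − A₁ (m₁ − m₂₃))`, i.e. KN's BHK slack of sector II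
exceeds `(ψ₁ − φ₁) μ(M ∩ {a₃↔b})`.  With `sector_delta_le`, `sector_psi_ge_phi` and `knThm2_tau_sub` this gives (II).
[this file; cite: KozmaNitzan2024, Theorem 2 (pp. 8–9)] -/
theorem sectorII_of_sigma (w : Sym2 (Fin n) → unitInterval) (o b a₁ a₂ a₃ : Fin n) (h12 : a₁ ≠ a₂) (h13 : a₁ ≠ a₃)
    (hτ₁ : (prodBernoulli w).real (openConn a₃ b) ≤ (prodBernoulli w).real (openConn a₁ b))
    (hSig : ((prodBernoulli w).real ((openConn a₁ a₂)ᶜ ∩ (openConn a₁ a₃)ᶜ : Set (BondConfig (Fin n))) *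
              (prodBernoulli w).real ((openConn a₁ a₂)ᶜ ∩ (openConn a₁ a₃)ᶜ ∩ (openConn a₂ a₃)ᶜ ∩ openConn a₁ o) -
            (prodBernoulli w).real ((openConn a₁ a₂)ᶜ ∩ (openConn a₁ a₃)ᶜ ∩ (openConn a₂ a₃)ᶜ : Set (BondConfig (Fin n))) *
              (prodBernoulli w).real ((openConn a₁ a₂)ᶜ ∩ (openConn a₁ a₃)ᶜ ∩ openConn a₁ o)) *
          (prodBernoulli w).real ((openConn a₁ a₂)ᶜ ∩ (openConn a₁ a₃)ᶜ ∩ (openConn a₂ a₃)ᶜ ∩ openConn a₃ b) ≤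
        (prodBernoulli w).real ((openConn a₁ a₂)ᶜ ∩ (openConn a₁ a₃)ᶜ ∩ (openConn a₂ a₃)ᶜ : Set (BondConfig (Fin n))) *
          ((prodBernoulli w).real ((openConn a₁ a₂)ᶜ ∩ (openConn a₁ a₃)ᶜ : Set (BondConfig (Fin n))) *
              ((prodBernoulli w).real ((openConn a₁ a₂)ᶜ ∩ (openConn a₁ a₃)ᶜ ∩ (openConn a₁ o ∩ openConn a₁ b)) -
                (prodBernoulli w).real ((openConn a₁ a₂)ᶜ ∩ (openConn a₁ a₃)ᶜ ∩ (openConn a₁ o ∩ (openConn a₂ b ∩ openConn a₃ b)))) -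
            (prodBernoulli w).real ((openConn a₁ a₂)ᶜ ∩ (openConn a₁ a₃)ᶜ ∩ openConn a₁ o) *
              ((prodBernoulli w).real ((openConn a₁ a₂)ᶜ ∩ (openConn a₁ a₃)ᶜ ∩ openConn a₁ b) -
                (prodBernoulli w).real ((openConn a₁ a₂)ᶜ ∩ (openConn a₁ a₃)ᶜ ∩ (openConn a₂ b ∩ openConn a₃ b))))) :
    (prodBernoulli w).real ((openConn a₁ a₂)ᶜ ∩ (openConn a₁ a₃)ᶜ ∩ (openConn a₂ a₃)ᶜ : Set (BondConfig (Fin n))) *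
          (prodBernoulli w).real ((openConn a₁ a₂)ᶜ ∩ (openConn a₁ a₃)ᶜ ∩ openConn a₁ o) *
          ((prodBernoulli w).real (openConn a₁ b) - (prodBernoulli w).real (openConn a₃ b)) +
        (prodBernoulli w).real ((openConn a₁ a₂)ᶜ ∩ (openConn a₁ a₃)ᶜ : Set (BondConfig (Fin n))) *
          (prodBernoulli w).real ((openConn a₁ a₂)ᶜ ∩ (openConn a₁ a₃)ᶜ ∩ (openConn a₂ a₃)ᶜ ∩ openConn a₁ o) *
          ((prodBernoulli w).real ((openConn a₁ a₃)ᶜ ∩ (openConn a₂ a₃)ᶜ ∩ openConn a₃ b) -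
            (prodBernoulli w).real ((openConn a₁ a₃)ᶜ ∩ (openConn a₂ a₃)ᶜ ∩ (openConn a₁ b ∩ openConn a₂ b))) ≤
      (prodBernoulli w).real ((openConn a₁ a₂)ᶜ ∩ (openConn a₁ a₃)ᶜ : Set (BondConfig (Fin n))) *
        (prodBernoulli w).real ((openConn a₁ a₂)ᶜ ∩ (openConn a₁ a₃)ᶜ ∩ (openConn a₂ a₃)ᶜ : Set (BondConfig (Fin n))) *
        ((prodBernoulli w).real ((openConn a₁ a₂)ᶜ ∩ (openConn a₁ a₃)ᶜ ∩ (openConn a₁ o ∩ openConn a₁ b)) -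
          (prodBernoulli w).real ((openConn a₁ a₂)ᶜ ∩ (openConn a₁ a₃)ᶜ ∩ (openConn a₁ o ∩ (openConn a₂ b ∩ openConn a₃ b)))) :=
  sectorII_arith hSig (knThm2_tau_sub w b a₁ a₂ a₃) (sector_delta_le w b a₁ a₂ a₃ h13 hτ₁) (sector_psi_ge_phi w o a₁ a₂ a₃ h12 h13)

/-- **Pre-FKG (3) at `a₃` for three relays ⟸ CLAIM-I-ψ ∧ Σ₁ ∧ Σ₂.**  The residual of the first open rung of the
D-cone / KN-Question-9 line (`stub_dcone` at `|A ∖ b| = 3` = Kozma–Nitzan's open case `|A| = 3` of Question 7), cut into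
one hypothesis-carrying sector inequality (I) = CLAIM-I-ψ and the two HYPOTHESIS-FREE rows `Σ₁`, `Σ₂` (conjectural;
0 violations in the censuses of memo RESIDUAL-gen5.md, and `Σ₁` cuts the two-set-exchange pseudo-laws of the k = 3 certificate LPs).
[this file; cite: KozmaNitzan2024, Theorem 2 (pp. 8–9), Question 7 (p. 36)] -/
theorem preFKG3_of_claimI_sigma (w : Sym2 (Fin n) → unitInterval) (o b a₁ a₂ a₃ : Fin n)
    (h12 : a₁ ≠ a₂) (h13 : a₁ ≠ a₃) (h23 : a₂ ≠ a₃)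
    (hM : 0 < (prodBernoulli w).real ((openConn a₁ a₂)ᶜ ∩ (openConn a₁ a₃)ᶜ ∩ (openConn a₂ a₃)ᶜ : Set (BondConfig (Fin n))))
    (hτ₁ : (prodBernoulli w).real (openConn a₃ b) ≤ (prodBernoulli w).real (openConn a₁ b))
    (hτ₂ : (prodBernoulli w).real (openConn a₃ b) ≤ (prodBernoulli w).real (openConn a₂ b))
    (hI : ((prodBernoulli w).real ((openConn a₁ a₂)ᶜ ∩ (openConn a₁ a₃)ᶜ ∩ (openConn a₂ a₃)ᶜ ∩ openConn a₁ o) +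
            (prodBernoulli w).real ((openConn a₁ a₂)ᶜ ∩ (openConn a₁ a₃)ᶜ ∩ (openConn a₂ a₃)ᶜ ∩ openConn a₂ o)) *
          ((prodBernoulli w).real ((openConn a₁ a₃)ᶜ ∩ (openConn a₂ a₃)ᶜ ∩ (openConn a₁ b ∩ openConn a₂ b)) -
            (prodBernoulli w).real ((openConn a₁ a₃)ᶜ ∩ (openConn a₂ a₃)ᶜ ∩ openConn a₃ b)) ≤
        (prodBernoulli w).real ((openConn a₁ a₂)ᶜ ∩ (openConn a₁ a₃)ᶜ ∩ (openConn a₂ a₃)ᶜ : Set (BondConfig (Fin n))) *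
          ((prodBernoulli w).real ((openConn a₁ a₃)ᶜ ∩ (openConn a₂ a₃)ᶜ ∩ ((openConn a₁ o ∪ openConn a₂ o) ∩ (openConn a₁ b ∩ openConn a₂ b))) -
            (prodBernoulli w).real ((openConn a₁ a₃)ᶜ ∩ (openConn a₂ a₃)ᶜ ∩ ((openConn a₁ o ∪ openConn a₂ o) ∩ openConn a₃ b))))
    (hSig1 : ((prodBernoulli w).real ((openConn a₁ a₂)ᶜ ∩ (openConn a₁ a₃)ᶜ : Set (BondConfig (Fin n))) *
              (prodBernoulli w).real ((openConn a₁ a₂)ᶜ ∩ (openConn a₁ a₃)ᶜ ∩ (openConn a₂ a₃)ᶜ ∩ openConn a₁ o) -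
            (prodBernoulli w).real ((openConn a₁ a₂)ᶜ ∩ (openConn a₁ a₃)ᶜ ∩ (openConn a₂ a₃)ᶜ : Set (BondConfig (Fin n))) *
              (prodBernoulli w).real ((openConn a₁ a₂)ᶜ ∩ (openConn a₁ a₃)ᶜ ∩ openConn a₁ o)) *
          (prodBernoulli w).real ((openConn a₁ a₂)ᶜ ∩ (openConn a₁ a₃)ᶜ ∩ (openConn a₂ a₃)ᶜ ∩ openConn a₃ b) ≤
        (prodBernoulli w).real ((openConn a₁ a₂)ᶜ ∩ (openConn a₁ a₃)ᶜ ∩ (openConn a₂ a₃)ᶜ : Set (BondConfig (Fin n))) *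
          ((prodBernoulli w).real ((openConn a₁ a₂)ᶜ ∩ (openConn a₁ a₃)ᶜ : Set (BondConfig (Fin n))) *
              ((prodBernoulli w).real ((openConn a₁ a₂)ᶜ ∩ (openConn a₁ a₃)ᶜ ∩ (openConn a₁ o ∩ openConn a₁ b)) -
                (prodBernoulli w).real ((openConn a₁ a₂)ᶜ ∩ (openConn a₁ a₃)ᶜ ∩ (openConn a₁ o ∩ (openConn a₂ b ∩ openConn a₃ b)))) -
            (prodBernoulli w).real ((openConn a₁ a₂)ᶜ ∩ (openConn a₁ a₃)ᶜ ∩ openConn a₁ o) *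
              ((prodBernoulli w).real ((openConn a₁ a₂)ᶜ ∩ (openConn a₁ a₃)ᶜ ∩ openConn a₁ b) -
                (prodBernoulli w).real ((openConn a₁ a₂)ᶜ ∩ (openConn a₁ a₃)ᶜ ∩ (openConn a₂ b ∩ openConn a₃ b)))))
    (hSig2 : ((prodBernoulli w).real ((openConn a₂ a₁)ᶜ ∩ (openConn a₂ a₃)ᶜ : Set (BondConfig (Fin n))) *
              (prodBernoulli w).real ((openConn a₁ a₂)ᶜ ∩ (openConn a₁ a₃)ᶜ ∩ (openConn a₂ a₃)ᶜ ∩ openConn a₂ o) -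
            (prodBernoulli w).real ((openConn a₁ a₂)ᶜ ∩ (openConn a₁ a₃)ᶜ ∩ (openConn a₂ a₃)ᶜ : Set (BondConfig (Fin n))) *
              (prodBernoulli w).real ((openConn a₂ a₁)ᶜ ∩ (openConn a₂ a₃)ᶜ ∩ openConn a₂ o)) *
          (prodBernoulli w).real ((openConn a₁ a₂)ᶜ ∩ (openConn a₁ a₃)ᶜ ∩ (openConn a₂ a₃)ᶜ ∩ openConn a₃ b) ≤
        (prodBernoulli w).real ((openConn a₁ a₂)ᶜ ∩ (openConn a₁ a₃)ᶜ ∩ (openConn a₂ a₃)ᶜ : Set (BondConfig (Fin n))) *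
          ((prodBernoulli w).real ((openConn a₂ a₁)ᶜ ∩ (openConn a₂ a₃)ᶜ : Set (BondConfig (Fin n))) *
              ((prodBernoulli w).real ((openConn a₂ a₁)ᶜ ∩ (openConn a₂ a₃)ᶜ ∩ (openConn a₂ o ∩ openConn a₂ b)) -
                (prodBernoulli w).real ((openConn a₂ a₁)ᶜ ∩ (openConn a₂ a₃)ᶜ ∩ (openConn a₂ o ∩ (openConn a₁ b ∩ openConn a₃ b)))) -
            (prodBernoulli w).real ((openConn a₂ a₁)ᶜ ∩ (openConn a₂ a₃)ᶜ ∩ openConn a₂ o) *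
              ((prodBernoulli w).real ((openConn a₂ a₁)ᶜ ∩ (openConn a₂ a₃)ᶜ ∩ openConn a₂ b) -
                (prodBernoulli w).real ((openConn a₂ a₁)ᶜ ∩ (openConn a₂ a₃)ᶜ ∩ (openConn a₁ b ∩ openConn a₃ b))))) :
    (prodBernoulli w).real ((openConn o a₁ ∪ openConn o a₂ ∪ openConn o a₃) ∩ openConn a₃ b) ≤
      (prodBernoulli w).real ((openConn o a₁ ∪ openConn o a₂ ∪ openConn o a₃) ∩ openConn o b) := by
  have hII := sectorII_of_sigma w o b a₁ a₂ a₃ h12 h13 hτ₁ hSig1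
  have eM : ((openConn a₂ a₁)ᶜ ∩ (openConn a₂ a₃)ᶜ ∩ (openConn a₁ a₃)ᶜ : Set (BondConfig (Fin n))) =
      (openConn a₁ a₂)ᶜ ∩ (openConn a₁ a₃)ᶜ ∩ (openConn a₂ a₃)ᶜ := by
    ext ω
    simp only [Set.mem_inter_iff, Set.mem_compl_iff, knThm2_mem_openConn]
    constructor
    · rintro ⟨⟨h21, h23'⟩, h13'⟩
      exact ⟨⟨fun h => h21 h.symm, h13'⟩, h23'⟩
    · rintro ⟨⟨h12', h13'⟩, h23'⟩
      exact ⟨⟨fun h => h12' h.symm, h23'⟩, h13'⟩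
  have eN : ((openConn a₂ a₃)ᶜ ∩ (openConn a₁ a₃)ᶜ : Set (BondConfig (Fin n))) = (openConn a₁ a₃)ᶜ ∩ (openConn a₂ a₃)ᶜ :=
    Set.inter_comm _ _
  have eB : (openConn a₂ b ∩ openConn a₁ b : Set (BondConfig (Fin n))) = openConn a₁ b ∩ openConn a₂ b :=
    Set.inter_comm _ _
  have hIII := sectorII_of_sigma w o b a₂ a₁ a₃ h12.symm h23 hτ₂ (by rw [eM]; exact hSig2)
  rw [eM, eN, eB] at hIII
  exact preFKG3_of_sectorTransfer w o b a₁ a₂ a₃ hM hτ₁ hτ₂ hI hII hIII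

end

end Summit.CriticalPhenomena.PercolationContinuityZ3.Theorems
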